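import Summits.CriticalPhenomena.CardyFormulaZ2.Theorems.CardyComplexConeParafermionToSLESixFamiliesDiamondDartPhaseAssembly
import Summits.CriticalPhenomena.CardyFormulaZ2.Theorems.CardyComplexConeParafermionToSLESixFamiliesDiamondDartPhaseStart
import HarnessLib

/-!
# `BoundaryDartPhase`: the exact winding phase at first boundary darts of a marked diamond
# (line `potential-darboux-picard-diamond`, stub S1p `stub_boundaryDartPhase`)

Crux `ParafermionToSLESixFamilies` (stmt-CriticalPhenomena-11389), line `potential-darboux-picard-diamond`, stub
`stub_boundaryDartPhase` (S1p, skeleton r4): for a family of admissible FK Dobrushin data on a marked diamond there are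
unimodular anchors `u δ` such that, eventually along the family, at every first (transversally entering) boundary dart in
the bulk of an oriented boundary segment the phase `exp(-iπ T/6) · i^j · exp(∓iπ/6)` of the parafermionic observable
(`T` the turn count, configuration-independent by the corner-escape lemma) equals `u δ · diamondTau` EXACTLY.

Proof (seventeen helper files `…DiamondDartPhase*.lean` and `MedialExplorationCornerEscape.lean`): the lattice theorem
`T = T⋆(δ) + s` at free and wired first darts (corner-level escapes of Duminil-Copin–Hongler–Nolin with five classes of
escape routes; `turnCount_freeDart`, `turnCount_wiredDart`), the class and exponent algebra modulo twelve (`dartPhase_eq`),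
the counter-clockwise boundary loop and the arcs as its two complementary images (`exists_boundaryLoop_frame`,
`arcs_eq_of_loop`, `segment_orientation`) — assembled in `boundaryDartPhase_of_start` — and the position of the start
edge at the counter-clockwise start of the free arc (`eventually_startCorner_near_freeStart`: out-edge staircases from the
`B`-end of the start edge are `B`-coloured and would otherwise run into the bulk of the wired arc).
-/

namespace Summit.CriticalPhenomena.CardyFormulaZ2.Cruxes.ParafermionToSLESixFamilies.PotentialDarbouxPicardDiamond

/-- **S1p (`BoundaryDartPhase`)**: the exact, configuration-independent winding phase of the parafermionic observable at
the first boundary darts in the bulk of every oriented boundary segment of a marked diamond, with a unimodular anchor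
`u δ` per mesh. -/
theorem stub_boundaryDartPhase : BoundaryDartPhase :=
  boundaryDartPhase_of_start eventually_startCorner_near_freeStart

end Summit.CriticalPhenomena.CardyFormulaZ2.Cruxes.ParafermionToSLESixFamilies.PotentialDarbouxPicardDiamond
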